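/-
Copyright: b2b-lace packet (tail-bound analyst, gen 2). The FINITE-CLASS form of the `sup_{x ≠ 0}`
reduction for the SRW integrals `K_{n,l}(x)`: one kernel statement whose only inputs are numerical
upper bounds for `W_{n,j}` at an explicit finite list of lattice points (KSUP.md §9.2 PCS-K, now
unconditional by `parityMonotone_srwI`; and the `AbsMonotone` variant for the Lemma-M route).
-/
import Literature.Probability.FitznerVanDerHofstad2017.SrwIntegralParityMonotone
import HarnessLib

/-!
# `sup_{x ≠ 0} K_{n,l}(x)` is a finite maximum

For `d ≥ 2n + 1` and every `x ∈ ℤ^d ∖ {0}`: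
`K_{n,m+j}(x) ≤ max( K_{n,m+j}(e₀), √I_{n,2m}(0) · √B )` as soon as `B` bounds `W_{n,j}` at the
class representatives `1^{r₁} 2^{r₂}` (`2 ≤ r₁ + r₂ ≤ d`), `2e₀` and `3e₀`
(`srwK_le_max_of_classBounds`, unconditional: PCM is the kernel theorem `parityMonotone_srwI`);
the class-dependent-split forms `srwK_le_max_of_classSplits[_abs]` (`max_class min_split`, the
shape of the numerical screen KSUP.md §9.4); and the analogous statement with representatives `1^{r}` (`2 ≤ r ≤ d`), `2e₀` under the hypothesis
`AbsMonotone (I_{n,2j})` (= Lemma M / [HS92b] B.3 shape; `srwK_le_max_of_classBounds_abs`).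
Ingredients: `W_d`-invariance of `K`, `W` (from `DhatSym_spAct`); two points with the same
absolute-value profile counts lie in one `W_d`-orbit (`Equiv.ofFiberEquiv`, no sorting); counting
the profile of `x*` and of `1_S`.
-/

namespace Literature.Probability.FitznerVanDerHofstad2017

open MeasureTheory Real Finset
open Literature.Barriers.CriticalPhenomena
open Literature.Barriers.CriticalPhenomena.Slade2006Prop53 (P)
open Literature.Probability.LatticeModels

variable {d : ℕ}

/-! ### `W_d`-invariance of `K` and `W` -/

/-- `K_{n,l}(σ x) = K_{n,l}(x)` for every signed permutation `σ`.
[cite: FitznerVanDerHofstad2016NoBLE, (3.36) p. 1071] -/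
theorem srwK_spAct (n l : ℕ) (τ : SgnPermPair d) (x : Fin d → ℤ) :
    srwK d n l (spAct τ x) = srwK d n l x := by
  unfold srwK
  simp_rw [DhatSym_spAct]

/-- `W_{n,j}(σ x) = W_{n,j}(x)` for every signed permutation `σ`.
[cite: FitznerVanDerHofstad2016NoBLE, (5.16) p. 1093] -/
theorem srwW_spAct (n j : ℕ) (τ : SgnPermPair d) (x : Fin d → ℤ) :
    srwW d n j (spAct τ x) = srwW d n j x := by
  unfold srwW
  simp_rw [DhatSym_spAct]

/-- A transposition with a constant sign moves `a e_i` to `(s a) e_{i'}`. [folklore] -/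
theorem spAct_swap_axisVec (i i' : Fin d) (a : ℤ) (s : ℤˣ) :
    spAct (Equiv.swap i i', fun _ => s) (axisVec i a) = axisVec i' ((s : ℤ) * a) := by
  funext μ
  simp only [spAct_apply, axisVec]
  by_cases hμ : μ = i'
  · subst hμ
    simp [Equiv.swap_apply_right]
  · have hne : Equiv.swap i i' μ ≠ i := by
      rw [Equiv.swap_apply_def]
      split_ifs with h1
      · intro h; exact hμ (h1.trans h.symm)
      · exact h1
    rw [if_neg hne, if_neg hμ, mul_zero]

/-! ### Same absolute-value profile ⇒ same `W_d`-orbit -/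

/-- If `z` and `z'` have the same number of coordinates of each absolute value, then `z' = σ z` for
some signed permutation `σ` (fibrewise bijection + sign adjustment; no sorting needed). [folklore] -/
theorem exists_spAct_eq_of_card_abs_eq (z z' : Fin d → ℤ)
    (h : ∀ v : ℤ, Fintype.card {μ // |z μ| = v} = Fintype.card {μ // |z' μ| = v}) :
    ∃ τ : SgnPermPair d, spAct τ z = z' := by
  classical
  let e : ∀ v : ℤ, {i // (fun i => |z' i|) i = v} ≃ {a // (fun a => |z a|) a = v} :=
    fun v => Fintype.equivOfCardEq (h v).symm
  let ν : Fin d ≃ Fin d := Equiv.ofFiberEquiv e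
  have hν : ∀ i, |z (ν i)| = |z' i| := fun i => Equiv.ofFiberEquiv_map e i
  let δ : Fin d → ℤˣ := fun i => if 0 ≤ z' i * z (ν i) then 1 else -1
  refine ⟨(ν, δ), funext fun i => ?_⟩
  simp only [spAct_apply]
  show (δ i : ℤ) * z (ν i) = z' i
  have habs := hν i
  simp only [δ]
  rcases abs_eq_abs.mp habs with hzz | hzz
  · rw [if_pos (by rw [hzz]; exact mul_self_nonneg _)]
    push_cast
    rw [one_mul, hzz]
  · by_cases h0 : z' i = 0
    · rw [if_pos (by rw [h0, zero_mul])]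
      push_cast
      rw [one_mul, hzz, h0, neg_zero]
    · rw [if_neg (by rw [hzz]; nlinarith [mul_self_pos.mpr h0])]
      push_cast
      rw [hzz]
      ring

/-- `W_{n,j}` depends on `x` only through the profile `v ↦ #{μ : |x_μ| = v}`. [folklore] -/
theorem srwW_eq_of_card_abs_eq (n j : ℕ) (z z' : Fin d → ℤ)
    (h : ∀ v : ℤ, Fintype.card {μ // |z μ| = v} = Fintype.card {μ // |z' μ| = v}) :
    srwW d n j z = srwW d n j z' := by
  obtain ⟨τ, hτ⟩ := exists_spAct_eq_of_card_abs_eq z z' h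
  rw [← hτ, srwW_spAct]

/-! ### Class representatives and their profiles -/

/-- The class representative `1^{r₁} 2^{r₂} 0^{d-r₁-r₂} = (1,…,1,2,…,2,0,…,0)`. [folklore] -/
def classVec (d r₁ r₂ : ℕ) : Fin d → ℤ :=
  fun μ => if (μ : ℕ) < r₁ then 1 else if (μ : ℕ) < r₁ + r₂ then 2 else 0

/-- `{μ : Fin d // a ≤ μ < b} ≃ Fin (b - a)` for `b ≤ d`. [folklore] -/
def finIcoEquiv (d a b : ℕ) (hb : b ≤ d) :
    {μ : Fin d // a ≤ (μ : ℕ) ∧ (μ : ℕ) < b} ≃ Fin (b - a) where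
  toFun μ := ⟨(μ.1 : ℕ) - a, by have h := μ.2; omega⟩
  invFun i := ⟨⟨a + i, by have := i.2; omega⟩, by
    have := i.2
    constructor
    · show a ≤ a + (i : ℕ); omega
    · show a + (i : ℕ) < b; omega⟩
  left_inv μ := by
    apply Subtype.ext
    apply Fin.ext
    have h := μ.2
    show a + ((μ.1 : ℕ) - a) = (μ.1 : ℕ)
    omega
  right_inv i := by
    apply Fin.ext
    show a + (i : ℕ) - a = i
    omega

/-- `#{μ : Fin d | a ≤ μ < b} = b - a` for `b ≤ d`. [folklore] -/
theorem card_filter_Ico (d a b : ℕ) (hb : b ≤ d) :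
    (univ.filter (fun μ : Fin d => a ≤ (μ : ℕ) ∧ (μ : ℕ) < b)).card = b - a := by
  rw [← Fintype.card_subtype, Fintype.card_congr (finIcoEquiv d a b hb), Fintype.card_fin]

/-- The profile of the class representative. [folklore] -/
theorem card_abs_classVec (r₁ r₂ : ℕ) (h : r₁ + r₂ ≤ d) (v : ℤ) :
    (univ.filter (fun μ : Fin d => |classVec d r₁ r₂ μ| = v)).card =
      if v = 0 then d - (r₁ + r₂) else if v = 1 then r₁ else if v = 2 then r₂ else 0 := by
  by_cases h0 : v = 0
  · subst h0
    rw [if_pos rfl, show d - (r₁ + r₂) = d - (r₁ + r₂) from rfl, ← card_filter_Ico d (r₁ + r₂) d le_rfl]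
    congr 1
    ext μ
    simp only [mem_filter, mem_univ, true_and, classVec]
    constructor
    · intro hμ
      split_ifs at hμ with h1 h2
      · simp at hμ
      · simp at hμ
      · exact ⟨by omega, μ.2⟩
    · rintro ⟨h1, _⟩
      rw [if_neg (by omega), if_neg (by omega)]
      simp
  by_cases h1 : v = 1
  · subst h1
    rw [if_neg h0, if_pos rfl]
    have e : (univ.filter (fun μ : Fin d => |classVec d r₁ r₂ μ| = 1)) =
        univ.filter (fun μ : Fin d => 0 ≤ (μ : ℕ) ∧ (μ : ℕ) < r₁) := by
      ext μ
      simp only [mem_filter, mem_univ, true_and, classVec, zero_le]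
      constructor
      · intro hμ
        split_ifs at hμ with h1 h2
        · exact h1
        · simp at hμ
        · simp at hμ
      · intro hμ
        rw [if_pos hμ]
        simp
    rw [e, card_filter_Ico d 0 r₁ (by omega)]
    simp
  by_cases h2 : v = 2
  · subst h2
    rw [if_neg h0, if_neg h1, if_pos rfl]
    have e : (univ.filter (fun μ : Fin d => |classVec d r₁ r₂ μ| = 2)) =
        univ.filter (fun μ : Fin d => r₁ ≤ (μ : ℕ) ∧ (μ : ℕ) < r₁ + r₂) := by
      ext μ
      simp only [mem_filter, mem_univ, true_and, classVec]
      constructor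
      · intro hμ
        split_ifs at hμ with h1 h2
        · simp at hμ
        · exact ⟨by omega, h2⟩
        · simp at hμ
      · rintro ⟨hμ1, hμ2⟩
        rw [if_neg (by omega), if_pos hμ2]
        simp
    rw [e, card_filter_Ico d r₁ (r₁ + r₂) h]
    omega
  · rw [if_neg h0, if_neg h1, if_neg h2, Finset.card_eq_zero, Finset.filter_eq_empty_iff]
    intro μ _
    simp only [classVec]
    split_ifs <;> simp <;> omega

/-- `|x*_μ|` is `0`, `1` or `2` according as `x_μ` is `0`, odd, or even non-zero. [folklore] -/
theorem abs_prep (a : ℤ) : |prep a| = if a = 0 then 0 else if a % 2 = 0 then 2 else 1 := by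
  rcases prep_spec a with ⟨h0, hp⟩ | ⟨ha, h2, hp⟩ | ⟨ha, h2, hp⟩ | ⟨ha, h2, hp⟩ | ⟨ha, h2, hp⟩
  · subst h0; simp [prep]
  · rw [hp, if_neg ha.ne', if_neg (by omega)]; simp
  · rw [hp, if_neg ha.ne, if_neg (by omega)]; simp
  · rw [hp, if_neg ha.ne', if_pos h2]; simp
  · rw [hp, if_neg ha.ne, if_pos h2]; simp

/-- The number of odd coordinates of `x`. [folklore] -/
def oddCount (x : Fin d → ℤ) : ℕ := (univ.filter fun μ => x μ ≠ 0 ∧ x μ % 2 ≠ 0).card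

/-- The number of even non-zero coordinates of `x`. [folklore] -/
def evenCount (x : Fin d → ℤ) : ℕ := (univ.filter fun μ => x μ ≠ 0 ∧ x μ % 2 = 0).card

/-- The support size of `x`. [folklore] -/
def suppCount (x : Fin d → ℤ) : ℕ := (univ.filter fun μ => x μ ≠ 0).card

/-- `#odd + #even-nonzero = #support`. [folklore] -/
theorem oddCount_add_evenCount (x : Fin d → ℤ) : oddCount x + evenCount x = suppCount x := by
  unfold oddCount evenCount suppCount
  have h := Finset.card_filter_add_card_filter_not
    (s := univ.filter fun μ : Fin d => x μ ≠ 0) (p := fun μ => x μ % 2 ≠ 0)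
  rw [Finset.filter_filter, Finset.filter_filter] at h
  convert h using 3
  ext μ
  simp

/-- `#support + #zeros = d`. [folklore] -/
theorem suppCount_add_zero (x : Fin d → ℤ) :
    suppCount x + (univ.filter fun μ : Fin d => x μ = 0).card = d := by
  unfold suppCount
  have h := Finset.card_filter_add_card_filter_not
    (s := (univ : Finset (Fin d))) (p := fun μ => x μ ≠ 0)
  rw [Finset.card_univ, Fintype.card_fin] at h
  convert h using 3
  ext μ
  simp

/-- `#support ≤ d`. [folklore] -/
theorem suppCount_le (x : Fin d → ℤ) : suppCount x ≤ d := by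
  have := suppCount_add_zero x
  omega

/-- The profile of `x*`. [folklore] -/
theorem card_abs_parityRep (x : Fin d → ℤ) (v : ℤ) :
    (univ.filter (fun μ : Fin d => |parityRep x μ| = v)).card =
      if v = 0 then d - (oddCount x + evenCount x) else if v = 1 then oddCount x
      else if v = 2 then evenCount x else 0 := by
  simp only [parityRep, abs_prep]
  by_cases h0 : v = 0
  · subst h0
    rw [if_pos rfl, oddCount_add_evenCount,
      show d - suppCount x = (univ.filter fun μ : Fin d => x μ = 0).card by
        have := suppCount_add_zero x; omega]
    congr 1
    ext μ
    simp only [mem_filter, mem_univ, true_and]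
    split_ifs <;> simp_all
  by_cases h1 : v = 1
  · subst h1
    rw [if_neg h0, if_pos rfl]
    unfold oddCount
    congr 1
    ext μ
    simp only [mem_filter, mem_univ, true_and]
    split_ifs <;> simp_all
  by_cases h2 : v = 2
  · subst h2
    rw [if_neg h0, if_neg h1, if_pos rfl]
    unfold evenCount
    congr 1
    ext μ
    simp only [mem_filter, mem_univ, true_and]
    split_ifs <;> simp_all
  · rw [if_neg h0, if_neg h1, if_neg h2, Finset.card_eq_zero, Finset.filter_eq_empty_iff]
    intro μ _
    split_ifs <;> omega

/-- **`W(x*) = W(1^{r₁} 2^{r₂})`** with `r₁ = #odd`, `r₂ = #even-nonzero` coordinates of `x`.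
[folklore] -/
theorem srwW_parityRep_eq_classVec (n j : ℕ) (x : Fin d → ℤ) :
    srwW d n j (parityRep x) = srwW d n j (classVec d (oddCount x) (evenCount x)) := by
  apply srwW_eq_of_card_abs_eq
  intro v
  rw [Fintype.card_subtype, Fintype.card_subtype, card_abs_parityRep,
    card_abs_classVec _ _ (by rw [oddCount_add_evenCount]; exact suppCount_le x)]

/-- The profile of an indicator vector. [folklore] -/
theorem card_abs_indicatorVec (S : Finset (Fin d)) (v : ℤ) :
    (univ.filter (fun μ : Fin d => |indicatorVec S μ| = v)).card =
      if v = 0 then d - (S.card + 0) else if v = 1 then S.card else if v = 2 then 0 else 0 := by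
  simp only [indicatorVec_apply, add_zero]
  by_cases h0 : v = 0
  · subst h0
    rw [if_pos rfl, show d - S.card = Sᶜ.card by rw [Finset.card_compl, Fintype.card_fin]]
    congr 1
    ext μ
    simp only [mem_filter, mem_univ, true_and, Finset.mem_compl]
    split_ifs <;> simp_all
  by_cases h1 : v = 1
  · subst h1
    rw [if_neg h0, if_pos rfl]
    congr 1
    ext μ
    simp only [mem_filter, mem_univ, true_and]
    split_ifs <;> simp_all
  · rw [if_neg h0, if_neg h1, ite_self, Finset.card_eq_zero, Finset.filter_eq_empty_iff]
    intro μ _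
    split_ifs <;> simp <;> omega

/-- **`W(1_S) = W(1^{|S|})`**. [folklore] -/
theorem srwW_indicatorVec_eq_classVec (n j : ℕ) (S : Finset (Fin d)) :
    srwW d n j (indicatorVec S) = srwW d n j (classVec d S.card 0) := by
  apply srwW_eq_of_card_abs_eq
  intro v
  rw [Fintype.card_subtype, Fintype.card_subtype, card_abs_indicatorVec,
    card_abs_classVec _ _ (by simpa using Finset.card_le_univ S)]

/-! ### Support of size one: axis vectors -/

/-- A non-zero `x` has support of size `≥ 2`, or is an axis vector `a e_i`, `a ≠ 0`. [folklore] -/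
theorem two_le_suppCount_or_axis (x : Fin d → ℤ) (hx : x ≠ 0) :
    2 ≤ suppCount x ∨ ∃ (i : Fin d) (a : ℤ), a ≠ 0 ∧ x = axisVec i a := by
  classical
  by_cases h2 : 2 ≤ suppCount x
  · exact Or.inl h2
  right
  have hne : (univ.filter fun μ : Fin d => x μ ≠ 0).Nonempty := by
    by_contra hem
    rw [Finset.not_nonempty_iff_eq_empty, Finset.filter_eq_empty_iff] at hem
    apply hx
    funext μ
    have := hem (Finset.mem_univ μ)
    simpa using this
  have h1 : (univ.filter fun μ : Fin d => x μ ≠ 0).card = 1 := by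
    have := hne.card_pos
    unfold suppCount at h2
    omega
  obtain ⟨i, hi⟩ := Finset.card_eq_one.mp h1
  refine ⟨i, x i, ?_, funext fun μ => ?_⟩
  · have : i ∈ univ.filter fun μ : Fin d => x μ ≠ 0 := by rw [hi]; exact mem_singleton_self i
    simpa using this
  · simp only [axisVec]
    by_cases hμ : μ = i
    · subst hμ; simp
    · rw [if_neg hμ]
      by_contra hxμ
      have : μ ∈ univ.filter fun μ : Fin d => x μ ≠ 0 := by simpa using hxμ
      rw [hi, mem_singleton] at this
      exact hμ this

/-! ### The finite-class sup theorems -/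

/-- **PCS-K, finite-class form (unconditional).**  Let `d ≥ 2n + 1`, `e₀` the first axis vector, and
suppose `B` bounds `W_{n,j}` at the class representatives: `W_{n,j}(1^{r₁}2^{r₂}) ≤ B` for
`2 ≤ r₁ + r₂ ≤ d`, `W_{n,j}(2e₀) ≤ B`, `W_{n,j}(3e₀) ≤ B`.  Then for EVERY `x ≠ 0`:
`K_{n,m+j}(x) ≤ max(K_{n,m+j}(e₀), √I_{n,2m}(0) · √B)`.
Hence `sup_{x ≠ 0} K_{n,l}(x)` is the maximum of the `e₁` cell and finitely many certified numbers
(b2b-lace KSUP.md §9.2 PCS-K; PCM = `parityMonotone_srwI`). [folklore] -/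
theorem srwK_le_max_of_classBounds {n : ℕ} (hd : 2 * n + 1 ≤ d) (m j : ℕ) (B : ℝ)
    (hB : ∀ r₁ r₂ : ℕ, 2 ≤ r₁ + r₂ → r₁ + r₂ ≤ d → srwW d n j (classVec d r₁ r₂) ≤ B)
    (h2 : srwW d n j (axisVec ⟨0, by omega⟩ 2) ≤ B)
    (h3 : srwW d n j (axisVec ⟨0, by omega⟩ 3) ≤ B)
    (x : Fin d → ℤ) (hx : x ≠ 0) :
    srwK d n (m + j) x ≤
      max (srwK d n (m + j) (axisVec ⟨0, by omega⟩ 1))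
        (Real.sqrt (srwI d n (2 * m) 0) * Real.sqrt B) := by
  set e0 : Fin d := ⟨0, by omega⟩ with he0
  rcases two_le_suppCount_or_axis x hx with hsupp | ⟨i, a, ha, rfl⟩
  · -- support ≥ 2: x ↦ x* ↦ class representative
    refine le_trans ?_ (le_max_right _ _)
    apply srwK_le_sqrt_of_srwW_le hd m j x
    calc srwW d n j x ≤ srwW d n j (parityRep x) := srwW_le_srwW_parityRep' hd j x
      _ = srwW d n j (classVec d (oddCount x) (evenCount x)) := srwW_parityRep_eq_classVec n j x
      _ ≤ B := hB _ _ (by rw [oddCount_add_evenCount]; exact hsupp)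
          (by rw [oddCount_add_evenCount]; exact suppCount_le x)
  · -- axis vector `a e_i`
    rcases Int.emod_two_eq_zero_or_one a with heven | hodd
    · -- `a` even, `a ≠ 0`: `x* = 2 sgn(a) e_i`, same orbit as `2 e₀`
      refine le_trans ?_ (le_max_right _ _)
      apply srwK_le_sqrt_of_srwW_le hd m j
      have hrep : parityRep (axisVec i a) = axisVec i (2 * Int.sign a) := by
        funext μ
        simp only [parityRep, axisVec, prep]
        by_cases hμ : μ = i
        · subst hμ; simp [ha, heven]
        · simp [hμ]
      have hs : Int.sign a = 1 ∨ Int.sign a = -1 := by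
        rcases lt_or_gt_of_ne ha with h | h
        · exact Or.inr (Int.sign_eq_neg_one_of_neg h)
        · exact Or.inl (Int.sign_eq_one_of_pos h)
      obtain ⟨s, hs'⟩ : ∃ s : ℤˣ, (s : ℤ) = Int.sign a := by
        rcases hs with h | h
        · exact ⟨1, by simp [h]⟩
        · exact ⟨-1, by simp [h]⟩
      calc srwW d n j (axisVec i a) ≤ srwW d n j (parityRep (axisVec i a)) :=
            srwW_le_srwW_parityRep' hd j _
        _ = srwW d n j (axisVec i (2 * Int.sign a)) := by rw [hrep]
        _ = srwW d n j (spAct (Equiv.swap e0 i, fun _ => s) (axisVec e0 2)) := by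
            rw [spAct_swap_axisVec, hs', mul_comm]
        _ = srwW d n j (axisVec e0 2) := srwW_spAct n j _ _
        _ ≤ B := h2
    · rcases le_or_gt (|a|) 1 with hle | hgt
      · -- `|a| = 1`: `x = ± e_i`, same orbit as `e₀`
        refine le_trans (le_of_eq ?_) (le_max_left _ _)
        have ha1 : a = 1 ∨ a = -1 := by
          rcases (abs_le.mp hle) with ⟨h1, h2⟩
          omega
        obtain ⟨s, hs'⟩ : ∃ s : ℤˣ, (s : ℤ) = a := by
          rcases ha1 with h | h
          · exact ⟨1, by simp [h]⟩
          · exact ⟨-1, by simp [h]⟩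
        calc srwK d n (m + j) (axisVec i a)
            = srwK d n (m + j) (spAct (Equiv.swap e0 i, fun _ => s) (axisVec e0 1)) := by
              rw [spAct_swap_axisVec, hs', mul_one]
          _ = srwK d n (m + j) (axisVec e0 1) := srwK_spAct n _ _ _
      · -- `a` odd, `|a| ≥ 3` (`|a| = 2` is impossible for odd `a`): reduce to `3 e₀`
        have h3a : 3 ≤ |a| := by
          rcases Int.emod_two_eq_zero_or_one a with h | h
          · omega
          · simp only [Int.abs_eq_natAbs] at hgt ⊢
            omega
        refine le_trans ?_ (le_max_right _ _)
        apply srwK_le_sqrt_of_srwW_le hd m j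
        have hs : Int.sign a = 1 ∨ Int.sign a = -1 := by
          rcases lt_or_gt_of_ne ha with h | h
          · exact Or.inr (Int.sign_eq_neg_one_of_neg h)
          · exact Or.inl (Int.sign_eq_one_of_pos h)
        obtain ⟨s, hs'⟩ : ∃ s : ℤˣ, (s : ℤ) = Int.sign a := by
          rcases hs with h | h
          · exact ⟨1, by simp [h]⟩
          · exact ⟨-1, by simp [h]⟩
        calc srwW d n j (axisVec i a) ≤ srwW d n j (axisVec i (3 * Int.sign a)) :=
            srwW_le_srwW_axis_three' hd j i a h3a hodd
          _ = srwW d n j (spAct (Equiv.swap e0 i, fun _ => s) (axisVec e0 3)) := by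
            rw [spAct_swap_axisVec, hs', mul_comm]
          _ = srwW d n j (axisVec e0 3) := srwW_spAct n j _ _
          _ ≤ B := h3

/-- **Finite-class form for the `AbsMonotone` route** (hypothesis = [HS92b] B.3-shape coordinatewise
monotonicity of `I_{n,2j}` transported, i.e. Lemma M): representatives `1^{r}` (`2 ≤ r ≤ d`) and
`2e₀` suffice: for every `x ≠ 0`, `K_{n,m+j}(x) ≤ max(K_{n,m+j}(e₀), √I_{n,2m}(0) · √B)`.
(b2b-lace KSUP.md §8 WSUP-PRINT / carver-g6 KWrig.) [folklore] -/
theorem srwK_le_max_of_classBounds_abs {n : ℕ} (hd : 2 * n + 1 ≤ d) (m j : ℕ)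
    (hmono : AbsMonotone (srwI d n (2 * j))) (B : ℝ)
    (hB : ∀ r : ℕ, 2 ≤ r → r ≤ d → srwW d n j (classVec d r 0) ≤ B)
    (h2 : srwW d n j (axisVec ⟨0, by omega⟩ 2) ≤ B)
    (x : Fin d → ℤ) (hx : x ≠ 0) :
    srwK d n (m + j) x ≤
      max (srwK d n (m + j) (axisVec ⟨0, by omega⟩ 1))
        (Real.sqrt (srwI d n (2 * m) 0) * Real.sqrt B) := by
  classical
  set e0 : Fin d := ⟨0, by omega⟩ with he0
  rcases two_le_suppCount_or_axis x hx with hsupp | ⟨i, a, ha, rfl⟩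
  · refine le_trans ?_ (le_max_right _ _)
    apply srwK_le_sqrt_of_srwW_le hd m j x
    -- pass to `|x|`, then to `1_S`, then to `1^{|S|}`
    set S : Finset (Fin d) := univ.filter fun μ => x μ ≠ 0 with hS
    have hxabs : srwW d n j x = srwW d n j (fun μ => |x μ|) := by
      rw [← spAct_signUnits x, srwW_spAct]
    have hcard : S.card = suppCount x := rfl
    calc srwW d n j x = srwW d n j (fun μ => |x μ|) := hxabs
      _ ≤ srwW d n j (indicatorVec S) := by
          refine srwW_le_srwW_indicator hd j hmono S _ (fun μ hμ => ?_) (fun μ hμ => ?_)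
          · have : x μ ≠ 0 := by simpa [hS] using hμ
            have := abs_pos.mpr this
            omega
          · have : ¬ x μ ≠ 0 := by simpa [hS] using hμ
            push Not at this
            simp [this]
      _ = srwW d n j (classVec d S.card 0) := srwW_indicatorVec_eq_classVec n j S
      _ ≤ B := hB _ (by rw [hcard]; exact hsupp) (by rw [hcard]; exact suppCount_le x)
  · rcases le_or_gt (|a|) 1 with hle | hgt
    · refine le_trans (le_of_eq ?_) (le_max_left _ _)
      have ha1 : a = 1 ∨ a = -1 := by
        rcases (abs_le.mp hle) with ⟨h1, h2⟩
        omega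
      obtain ⟨s, hs'⟩ : ∃ s : ℤˣ, (s : ℤ) = a := by
        rcases ha1 with h | h
        · exact ⟨1, by simp [h]⟩
        · exact ⟨-1, by simp [h]⟩
      calc srwK d n (m + j) (axisVec i a)
          = srwK d n (m + j) (spAct (Equiv.swap e0 i, fun _ => s) (axisVec e0 1)) := by
            rw [spAct_swap_axisVec, hs', mul_one]
        _ = srwK d n (m + j) (axisVec e0 1) := srwK_spAct n _ _ _
    · refine le_trans ?_ (le_max_right _ _)
      apply srwK_le_sqrt_of_srwW_le hd m j
      have h2a : 2 ≤ |a| := by omega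
      calc srwW d n j (axisVec i a) ≤ srwW d n j (axisVec i 2) :=
            srwW_le_srwW_axis_two hd j hmono i a h2a
        _ = srwW d n j (spAct (Equiv.swap e0 i, fun _ => (1 : ℤˣ)) (axisVec e0 2)) := by
            rw [spAct_swap_axisVec]; simp
        _ = srwW d n j (axisVec e0 2) := srwW_spAct n j _ _
        _ ≤ B := h2


/-! ### Class-dependent splits (the form used by the numerical screen KSUP.md §9.4) -/

/-- **PCS-K with class-dependent Cauchy–Schwarz splits (unconditional).**  If for every class
representative `c ∈ {1^{r₁}2^{r₂} : 2 ≤ r₁+r₂ ≤ d} ∪ {2e₀, 3e₀}` SOME split `l = m + j` has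
`√I_{n,2m}(0) · √W_{n,j}(c) ≤ B`, then `K_{n,l}(x) ≤ max(K_{n,l}(e₀), B)` for every `x ≠ 0`
(this is `max_class min_split`, sharper than `min_split max_class`). [folklore] -/
theorem srwK_le_max_of_classSplits {n : ℕ} (hd : 2 * n + 1 ≤ d) (l : ℕ) (B : ℝ)
    (hB : ∀ r₁ r₂ : ℕ, 2 ≤ r₁ + r₂ → r₁ + r₂ ≤ d → ∃ m j, m + j = l ∧
      Real.sqrt (srwI d n (2 * m) 0) * Real.sqrt (srwW d n j (classVec d r₁ r₂)) ≤ B)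
    (h2 : ∃ m j, m + j = l ∧
      Real.sqrt (srwI d n (2 * m) 0) * Real.sqrt (srwW d n j (axisVec ⟨0, by omega⟩ 2)) ≤ B)
    (h3 : ∃ m j, m + j = l ∧
      Real.sqrt (srwI d n (2 * m) 0) * Real.sqrt (srwW d n j (axisVec ⟨0, by omega⟩ 3)) ≤ B)
    (x : Fin d → ℤ) (hx : x ≠ 0) :
    srwK d n l x ≤ max (srwK d n l (axisVec ⟨0, by omega⟩ 1)) B := by
  set e0 : Fin d := ⟨0, by omega⟩ with he0
  rcases two_le_suppCount_or_axis x hx with hsupp | ⟨i, a, ha, rfl⟩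
  · refine le_trans ?_ (le_max_right _ _)
    obtain ⟨m, j, rfl, hle⟩ := hB (oddCount x) (evenCount x)
      (by rw [oddCount_add_evenCount]; exact hsupp) (by rw [oddCount_add_evenCount]; exact suppCount_le x)
    refine le_trans (srwK_le_sqrt_of_srwW_le hd m j x ?_) hle
    rw [← srwW_parityRep_eq_classVec]
    exact srwW_le_srwW_parityRep' hd j x
  · have hs : Int.sign a = 1 ∨ Int.sign a = -1 := by
      rcases lt_or_gt_of_ne ha with h | h
      · exact Or.inr (Int.sign_eq_neg_one_of_neg h)
      · exact Or.inl (Int.sign_eq_one_of_pos h)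
    obtain ⟨s, hs'⟩ : ∃ s : ℤˣ, (s : ℤ) = Int.sign a := by
      rcases hs with h | h
      · exact ⟨1, by simp [h]⟩
      · exact ⟨-1, by simp [h]⟩
    rcases Int.emod_two_eq_zero_or_one a with heven | hodd
    · refine le_trans ?_ (le_max_right _ _)
      obtain ⟨m, j, rfl, hle⟩ := h2
      refine le_trans (srwK_le_sqrt_of_srwW_le hd m j _ ?_) hle
      have hrep : parityRep (axisVec i a) = axisVec i (2 * Int.sign a) := by
        funext μ
        simp only [parityRep, axisVec, prep]
        by_cases hμ : μ = i
        · subst hμ; simp [ha, heven]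
        · simp [hμ]
      calc srwW d n j (axisVec i a) ≤ srwW d n j (parityRep (axisVec i a)) :=
            srwW_le_srwW_parityRep' hd j _
        _ = srwW d n j (axisVec i (2 * Int.sign a)) := by rw [hrep]
        _ = srwW d n j (spAct (Equiv.swap e0 i, fun _ => s) (axisVec e0 2)) := by
            rw [spAct_swap_axisVec, hs', mul_comm]
        _ = srwW d n j (axisVec e0 2) := srwW_spAct n j _ _
    · rcases le_or_gt (|a|) 1 with hle | hgt
      · refine le_trans (le_of_eq ?_) (le_max_left _ _)
        have ha1 : a = 1 ∨ a = -1 := by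
          rcases (abs_le.mp hle) with ⟨h1, h2⟩
          omega
        obtain ⟨s1, hs1⟩ : ∃ s : ℤˣ, (s : ℤ) = a := by
          rcases ha1 with h | h
          · exact ⟨1, by simp [h]⟩
          · exact ⟨-1, by simp [h]⟩
        calc srwK d n l (axisVec i a)
            = srwK d n l (spAct (Equiv.swap e0 i, fun _ => s1) (axisVec e0 1)) := by
              rw [spAct_swap_axisVec, hs1, mul_one]
          _ = srwK d n l (axisVec e0 1) := srwK_spAct n _ _ _
      · have h3a : 3 ≤ |a| := by
          simp only [Int.abs_eq_natAbs] at hgt ⊢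
          omega
        refine le_trans ?_ (le_max_right _ _)
        obtain ⟨m, j, rfl, hle⟩ := h3
        refine le_trans (srwK_le_sqrt_of_srwW_le hd m j _ ?_) hle
        calc srwW d n j (axisVec i a) ≤ srwW d n j (axisVec i (3 * Int.sign a)) :=
            srwW_le_srwW_axis_three' hd j i a h3a hodd
          _ = srwW d n j (spAct (Equiv.swap e0 i, fun _ => s) (axisVec e0 3)) := by
            rw [spAct_swap_axisVec, hs', mul_comm]
          _ = srwW d n j (axisVec e0 3) := srwW_spAct n j _ _

/-- **Class-dependent splits, `AbsMonotone` route** (representatives `1^{r}`, `2 ≤ r ≤ d`, and `2e₀`;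
hypothesis `AbsMonotone (I_{n,2j})` for every `j` used). [folklore] -/
theorem srwK_le_max_of_classSplits_abs {n : ℕ} (hd : 2 * n + 1 ≤ d) (l : ℕ)
    (hmono : ∀ j, AbsMonotone (srwI d n (2 * j))) (B : ℝ)
    (hB : ∀ r : ℕ, 2 ≤ r → r ≤ d → ∃ m j, m + j = l ∧
      Real.sqrt (srwI d n (2 * m) 0) * Real.sqrt (srwW d n j (classVec d r 0)) ≤ B)
    (h2 : ∃ m j, m + j = l ∧
      Real.sqrt (srwI d n (2 * m) 0) * Real.sqrt (srwW d n j (axisVec ⟨0, by omega⟩ 2)) ≤ B)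
    (x : Fin d → ℤ) (hx : x ≠ 0) :
    srwK d n l x ≤ max (srwK d n l (axisVec ⟨0, by omega⟩ 1)) B := by
  classical
  set e0 : Fin d := ⟨0, by omega⟩ with he0
  rcases two_le_suppCount_or_axis x hx with hsupp | ⟨i, a, ha, rfl⟩
  · refine le_trans ?_ (le_max_right _ _)
    set S : Finset (Fin d) := univ.filter fun μ => x μ ≠ 0 with hS
    have hcard : S.card = suppCount x := rfl
    obtain ⟨m, j, rfl, hle⟩ := hB S.card (by rw [hcard]; exact hsupp)
      (by rw [hcard]; exact suppCount_le x)
    refine le_trans (srwK_le_sqrt_of_srwW_le hd m j x ?_) hle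
    calc srwW d n j x = srwW d n j (fun μ => |x μ|) := by rw [← spAct_signUnits x, srwW_spAct]
      _ ≤ srwW d n j (indicatorVec S) := by
          refine srwW_le_srwW_indicator hd j (hmono j) S _ (fun μ hμ => ?_) (fun μ hμ => ?_)
          · have : x μ ≠ 0 := by simpa [hS] using hμ
            have := abs_pos.mpr this
            omega
          · have : ¬ x μ ≠ 0 := by simpa [hS] using hμ
            push Not at this
            simp [this]
      _ = srwW d n j (classVec d S.card 0) := srwW_indicatorVec_eq_classVec n j S
  · rcases le_or_gt (|a|) 1 with hle | hgt
    · refine le_trans (le_of_eq ?_) (le_max_left _ _)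
      have ha1 : a = 1 ∨ a = -1 := by
        rcases (abs_le.mp hle) with ⟨h1, h2⟩
        omega
      obtain ⟨s1, hs1⟩ : ∃ s : ℤˣ, (s : ℤ) = a := by
        rcases ha1 with h | h
        · exact ⟨1, by simp [h]⟩
        · exact ⟨-1, by simp [h]⟩
      calc srwK d n l (axisVec i a)
          = srwK d n l (spAct (Equiv.swap e0 i, fun _ => s1) (axisVec e0 1)) := by
            rw [spAct_swap_axisVec, hs1, mul_one]
        _ = srwK d n l (axisVec e0 1) := srwK_spAct n _ _ _
    · refine le_trans ?_ (le_max_right _ _)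
      obtain ⟨m, j, rfl, hle⟩ := h2
      refine le_trans (srwK_le_sqrt_of_srwW_le hd m j _ ?_) hle
      have h2a : 2 ≤ |a| := by omega
      calc srwW d n j (axisVec i a) ≤ srwW d n j (axisVec i 2) :=
            srwW_le_srwW_axis_two hd j (hmono j) i a h2a
        _ = srwW d n j (spAct (Equiv.swap e0 i, fun _ => (1 : ℤˣ)) (axisVec e0 2)) := by
            rw [spAct_swap_axisVec]; simp
        _ = srwW d n j (axisVec e0 2) := srwW_spAct n j _ _

end Literature.Probability.FitznerVanDerHofstad2017
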